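import Literature.MathematicalPhysics.QuantumFieldTheory.Balaban1983to89.B9Eq342GreenPrimeTowerSupBoundDecayCosh
import Literature.MathematicalPhysics.QuantumFieldTheory.Balaban1983to89.B9Eq347LocalFromBlockDecay
import Literature.MathematicalPhysics.QuantumFieldTheory.Balaban1983to89.Beta.RemainderHasMajGreenPrime

/-!
# T. Bałaban, *Propagators for lattice gauge theories in a background field*, Commun. Math. Phys. **99** (1985) 389–434
# [Balaban1985BackgroundPropagators] Thm 3.1 (3.42) WITH DECAY AT `k = n+1` AVERAGING LEVELS for print's `G′_k(U)`, (W)+(D-FS) INHABITED — THE NE9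
# OWNER's `B9Eq342GreenPrimeTowerSupBoundDecayCosh.norm_GpOfUk_apply_le_decay_cosh` AS THE `hG`-SHAPED `B11SectG.HasMaj` OF ROW (D4) BETWEEN THE SUP
# SIZES OF (190) over the torus of UNIT blocks: letters (T), (D-P)_k, (D-E)_k only; on the chain's class (unitary `U`) (D-P)_k, (D-E)_k only

CITATION HEADER (lean-in-tree rule 2026-08-18).  Sources: [Balaban1985BackgroundPropagators] (B9; held
`paper:balaban1985-cmp99-background-propagators`, journal page = PDF page + 388): p. 397 (3.39), Thm 3.1 (3.42) *«There exist positive constants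
M₁, δ₀, a₀, B₀ dependent on d and L only … |(G′(U)λ)(x)| … ≦ B₀e^{−δ₀d(y,y′)}|λ| for x ∈ Δ(y), y ∈ Λ_j, supp λ ⊂ Δ(y′)»*, (3.19) p. 393 (the composite
averaging `Q′_k`), (3.24)–(3.25) p. 394 (`Δ′_a(U) = Δ^η_U + Q′*aQ′`, `G′ = (Δ′_a)⁻¹` — the SITE operator), (3.49) p. 399 (unit blocks `Δ(y)` = big blocks of
side `L^k` of the fine torus), (3.11) p. 392; [Balaban1984PropagatorsI] (B5) (1.29) p. 23, Prop. 1.1 p. 33, p. 36 (the exponential weight);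
[Balaban1985Variational] (B11) (180) p. 306, (190) p. 308; [Balaban1984PropagatorsII] (B6) (2.51)–(2.52) p. 232, (2.54) p. 233.  Read first-hand this gen:
[B9] pp. 394–395, 399, 406–409, 414–416 (see HONEST SCOPE).

WHY THIS FILE (audit cell `pub-balaban`, BINDER row (D4), OWNER lineage `b2b-balaban-beta-an4`, gen 108; the tower twin of `Beta.RemainderHasMajGreenPrimeDecayCosh`).
NODE D of row (D4) lives at height `k`: its `Δ(y)` are the UNIT blocks = the big blocks of side `L^k` of the `L^{−k}`-torus ((3.49)).  The NE9 OWNER's TOWER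
road WITH ITS WEIGHT LETTERS INHABITED is in the tree: `B9Eq342GreenPrimeTowerSupBoundDecayCosh.norm_GpOfUk_apply_le_decay_cosh` (p392527) — for `f`
supported in the big block `v`, `‖f(y)‖ ≤ F`, `‖f‖ ≤ √μF`, any rate `0 ≤ a` with `0 < λ = 1 − 2d·η⁻²(cosh a − 1)`, depth `k′ ≥ d`, `0 < η⁻¹ ≤ L^{n+1}m_ν`,
`c₀η^{−d} = c₁`, `0 ≤ κ′ ≤ κ`, `2κ′ < aL^{n+1}`:
`‖(G′_k(U)f)(x₀)‖ ≤ B_k·e^{−κ′d_m(Πx₀,v)}·F`, `Π = blockCoord (L^k) m ∘ siteCast`,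
`B_k = (1 + p₂C_E√μ)·2e^{a(L^{n+1}−1)}·Σ_{l<k′}λ^{−(l+1)} + √(3^d∕c₁·λ^{−k′})·√(2e^{a(L^{n+1}−1)}·K_d(aL^{n+1} − 2κ′))·C_E·√μ`,
modulo the letters (T) `hR`∕`hS`, (D-P)_k `hP` (block-local penalty), (D-E)_k `hdec` (`L²` big-block decay).  THIS FILE plugs it into row (D4)'s
carrier-generic socket `RemainderHasMajGreenPrime.hasMaj_supSize_of_local`, the big-block mass `μ = c₀(L^k)^d` COUNTED
(`B9Eq342TowerBigBlocks.card_sites_bigBlock_le` + `B9Eq347LocalFromBlockDecay.norm_le_sqrt_mass_mul`):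
* **`hasMaj_GpOfUk_of_cosh_letters_sup`** — `HasMaj S_m S_m ((e ∘ G′_k(U) ∘ e⁻¹)↾ℝ) (B_k·e^{−κ′·d_∞})` over the torus of unit blocks `UT m` in
  `toB6 (torusGeom m η₀ L₀ M₀) R H`, boxes = fibres of `Π`, letters (T), (D-P)_k, (D-E)_k;
* **`hasMaj_GpOfUk_of_cosh_letters`** — the same with the kernel `B_k·e^{−(κ′∕d)·g.dist}` and the operator packaged `(𝒢.restrictScalars ℝ : 𝒴 →ₗ[ℝ] 𝒴)` — token for
  token the `hG` binder of `Beta.RemainderChartOriginDerivative.ineq190_fderiv_chartH179_zero_of_letters` at height `k = n+1`;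
* **`hasMaj_GpOfUk_of_cosh_letters_unitary`** — on the chain's class (unitary `U`, a `*`-trace, compatible fibre norm) (T) holds with equality
  (`B9Eq342GreenPrimeSupBound.norm_adTransportW_eq`∕`…_inv_eq`): letters (D-P)_k + (D-E)_k ONLY.
HEIGHT-FREE READING (NE9's, not re-proved here): on the diagonal `η⁻¹ = L^{n+1}`, `c₀(L^{n+1})^d = c₁`, at `a⋆ = (4dL^{2(n+1)} + 1)^{−1∕2}` (`rate_explicit`) one has
`λ ≥ 1∕2`, `a⋆L^{n+1} ≥ 1∕√(4d+1)`, `2e^{a⋆(L^{n+1}−1)} ≤ 2e^{1∕2}` — `B9Eq342GreenPrimeTowerSupBoundDecayCosh.norm_GpOfUk_apply_le_rowSum_heightFree`; the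
corresponding height-free `HasMaj` is a further corollary (not here).

HONEST SCOPE.  [folklore] plumbing (NE9's theorem BY NAME + the socket + big-block mass counting + the unitary (T)); NO estimate of [5] is proved here;
(T)∕(D-P)_k∕(D-E)_k stay HYPOTHESES exactly as the road prints them (NE9's programme: (D-P)_k height-free is their staged `…TowerSupBoundDecayPenalty`).  THE
OPERATOR IS [5] THM 3.1's SITE OPERATOR `G′_k(U) = (Δ′_{a′,k}(U))⁻¹` ((3.24), gauge-transformation parameters), NOT Thm 3.3's BOND operator
`G(U) = (Δ(U) + DR(U)D* + Q*aQ)⁻¹` ((3.26), vector fields) on which [15]'s `G̃` of (182) is built: the junction is at the level of the SHAPE of (3.42).  Print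
proves Thm 3.3 by Sect. C's generalized random walk — `Δ_a(U′U) = (I − V(A)G(U))Δ_a(U)` (3.82)–(3.84), `G(U′U) = G(U)(I − V(A)G(U))⁻¹` (3.86),
Cor. 3.5–3.6 p. 408 (flat [4] at `U = 1`), glue (3.87), commutators (3.88)∕(3.104), `Δ_aG₀ = I − R` (3.105), `G = G₀(I − R)⁻¹` (3.106), Thm 3.10
(3.107)–(3.108) ⟹ Thm 3.3 — the road of `Summit.QuantumFields.BalabanUV.Gaps.D4WalkBlock*`; nothing of it is claimed here.  Nothing identifies Bałaban's
step-`k` objects (NODE O).  Row (D4) class UNCHANGED (instance 0∕1; D4 DISCHARGE NO DATE); NOT B12 Thm 2, NOT BetaPertH, NOT continuum, NOT Clay.  HONEST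
DEPENDENCY (cell line): continuum YM on T⁴ ⇐ BetaPertH ∧ nine spine estimates (0/9 proved); BetaPertH ⇐ (D1) ∧ (D4) ∧ CAP+tail; G-an2-4 gates asym, D1
and NE2/3/4.  NEW file importing `B9Eq342GreenPrimeTowerSupBoundDecayCosh` + `B9Eq347LocalFromBlockDecay` + `Beta.RemainderHasMajGreenPrime`; nothing
modified; 0 `def`; standard axioms; no `sorry`.
-/

noncomputable section

open scoped BigOperators InnerProductSpace

namespace Literature.MathematicalPhysics.QuantumFieldTheory.Balaban1983to89.Beta.RemainderHasMajGreenPrimeTowerDecayCosh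

open B11SectG B11SupSize190
open B4Sect5Torus (TSite tdist ccoord tdist_nonneg)
open B4Sect5Proof (latticeConst)
open B5TorusCover (UT)
open B9Thm34Ext (toB6)
open B9Thm37GlueTorus (torusGeom tdist1)
open B9SectCLatticeCarrier (Bond shift unshift)
open B9Eq311L2Pairing (WL2)
open B9Eq319QprimeTorus (fineP blockCoord)
open B9Eq315QTower (towerP)
open B9Eq316TowerFlatIsOneStep (towerP_eq_fineP_pow siteCast)
open B9Eq310HessianOperator (adTransportW)
open B11Eq103H1Complex (SiteL2K covLaplaceSiteK)
open B9Eq324DeltaPrimeATower (laplacePrimeAk GpOfUk)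
open B9Eq342GreenPrimeSupBound (norm_adTransportW_eq norm_adTransportW_inv_eq)
open B9Eq342GreenPrimeTowerSupBoundDecayCosh (norm_GpOfUk_apply_le_decay_cosh)
open B9Eq342TowerBigBlocks (card_sites_bigBlock_le)
open B9Eq347LocalFromBlockDecay (norm_le_sqrt_mass_mul)
open Beta.RemainderHasMajGreenPrime (hasMaj_supSize_of_local)

/-! ### Torus bookkeeping (as in `Beta.RemainderHasMajGreenPrime`; private) -/

section Aux

variable {d : ℕ} {m : Fin d → ℕ}

/-- `ofSite a = y ↔ a = toSite y`. [folklore] -/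
private theorem ofSite_eq_iff (a : TSite d m) (y : UT m) : UT.ofSite m a = y ↔ a = UT.toSite m y := by
  constructor
  · rintro rfl; rfl
  · rintro rfl; rfl

/-- The boxes of the big-block map `Π = blockCoord (L^k) m ∘ siteCast` are its fibres. [folklore] -/
private theorem mem_bigBox_iff {L k : ℕ} (y : UT m) (x : TSite d (towerP L m k)) :
    x ∈ (Finset.univ.filter fun x : TSite d (towerP L m k) =>
        blockCoord (L ^ k) m (siteCast (towerP_eq_fineP_pow L m k) x) = UT.toSite m y) ↔
      UT.ofSite m (blockCoord (L ^ k) m (siteCast (towerP_eq_fineP_pow L m k) x)) = y := by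
  rw [Finset.mem_filter, ofSite_eq_iff]
  simp

variable [∀ i, NeZero (m i)]

/-- `d₁ ≤ d·d_∞` on the torus of blocks. [folklore] -/
private theorem tdist1_le_mul_tdist (y v : UT m) :
    tdist1 m y v ≤ d * tdist m (UT.toSite m y) (UT.toSite m v) := by
  unfold tdist1 tdist
  have h : ∀ i ∈ (Finset.univ : Finset (Fin d)),
      ((ccoord m (UT.toSite m y) (UT.toSite m v) i : ℕ) : ℝ) ≤
        ((Finset.univ.sup (ccoord m (UT.toSite m y) (UT.toSite m v)) : ℕ) : ℝ) :=
    fun i hi => by exact_mod_cast Finset.le_sup (f := ccoord m (UT.toSite m y) (UT.toSite m v)) hi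
  calc ∑ i, ((ccoord m (UT.toSite m y) (UT.toSite m v) i : ℕ) : ℝ)
      ≤ ∑ _i : Fin d, ((Finset.univ.sup (ccoord m (UT.toSite m y) (UT.toSite m v)) : ℕ) : ℝ) :=
        Finset.sum_le_sum h
    _ = d * ((Finset.univ.sup (ccoord m (UT.toSite m y) (UT.toSite m v)) : ℕ) : ℝ) := by
        rw [Finset.sum_const, Finset.card_univ, Fintype.card_fin, nsmul_eq_mul]

/-- `e^{−r·d_∞} ≤ e^{−(r/d)·d₁}` for `r ≥ 0`. [folklore] -/
private theorem exp_tdist_le_exp_tdist1 {r : ℝ} (hr : 0 ≤ r) (y v : UT m) :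
    Real.exp (-(r * tdist m (UT.toSite m y) (UT.toSite m v))) ≤ Real.exp (-(r / d * tdist1 m y v)) := by
  refine Real.exp_le_exp.mpr (neg_le_neg ?_)
  have h1 := tdist1_le_mul_tdist y v
  have ht : 0 ≤ tdist m (UT.toSite m y) (UT.toSite m v) := tdist_nonneg _ _ _
  rcases Nat.eq_zero_or_pos d with hd | hd
  · subst hd
    simp only [Nat.cast_zero, div_zero, zero_mul]
    exact mul_nonneg hr ht
  · have hd' : (0 : ℝ) < d := by exact_mod_cast hd
    calc r / d * tdist1 m y v ≤ r / d * (d * tdist m (UT.toSite m y) (UT.toSite m v)) :=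
          mul_le_mul_of_nonneg_left h1 (div_nonneg hr hd'.le)
      _ = r * tdist m (UT.toSite m y) (UT.toSite m v) := by
          field_simp

end Aux

/-! ## The tower road's (3.42) with the `cosh` weight IS the `hG`-shaped `HasMaj` at height `k = n+1`; letters (T), (D-P)_k, (D-E)_k -/

section Road

variable {d : ℕ} (L : ℕ) [NeZero L] (m : Fin d → ℕ) [∀ i, NeZero (m i)] (n : ℕ)
  {𝔸 : Type*} [NormedRing 𝔸] [NormedAlgebra ℂ 𝔸] [CompleteSpace 𝔸]
  {W : Type} [NormedAddCommGroup W] [InnerProductSpace ℂ W] [FiniteDimensional ℂ W] (φ : W ≃ₗ[ℂ] 𝔸) {c₀ : ℝ} [Fact (0 < c₀)]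
  (η : ℝ) (U : Bond d (towerP L m (n + 1)) → 𝔸ˣ) {c₁ : ℝ} [Fact (0 < c₁)] (a' : ℝ)
  (hpos' : ∀ x : SiteL2K ℂ d (towerP L m (n + 1)) c₀ W, x ≠ 0 → 0 < RCLike.re ⟪x, laplacePrimeAk L m n φ η U a' (c₁ := c₁) x⟫_ℂ)
  (η₀ L₀ M₀ R : ℝ) (H : Prop)

/-- **[5] THM 3.1 (3.42) AT HEIGHT `k = n+1` AS `HasMaj S_m S_m (G′_k(U)↾ℝ) (B_k·e^{−κ′·d_∞})`, (W)+(D-FS) INHABITED BY THE `cosh` WEIGHT.**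
Letters exactly as in `B9Eq342GreenPrimeTowerSupBoundDecayCosh.norm_GpOfUk_apply_le_decay_cosh`: (T) `hR`∕`hS`, a big-block family `hPS`, (D-P)_k `hP`,
(D-E)_k `hdec` for every source block; rate data `0 ≤ a`, `0 < λ`; `d ≤ k′` (the Lean `k`), `0 < η⁻¹ ≤ L^{n+1}m_ν`, `c₀η^{−d} = c₁`; `0 ≤ κ′ ≤ κ`,
`2κ′ < a·L^{n+1}`; the big-block mass `‖f‖ ≤ √(c₀(L^k)^d)·F` is COUNTED here.  Constant `B_k` as in the module docstring (free of the torus `m`).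
[cite: Balaban1985BackgroundPropagators, Thm 3.1 (3.42) p.397, (3.19) p.393, (3.24)–(3.25) p.394, (3.49) p.399, (3.11) p.392] [cite: Balaban1984PropagatorsI, Prop. 1.1 p.33, p.36]
[cite: Balaban1985Variational, (180) p.306, (190) p.308] [cite: Balaban1984PropagatorsII, (2.51)–(2.52) p.232] -/
theorem hasMaj_GpOfUk_of_cosh_letters_sup
    (hR : ∀ b w, ‖adTransportW φ U b w‖ ≤ ‖w‖) (hS : ∀ b w, ‖adTransportW φ (fun b => (U b)⁻¹) b w‖ ≤ ‖w‖)
    {PS : TSite d m → SiteL2K ℂ d (towerP L m (n + 1)) c₀ W →L[ℂ] SiteL2K ℂ d (towerP L m (n + 1)) c₀ W}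
    (hPS : ∀ (y : TSite d m) (g : SiteL2K ℂ d (towerP L m (n + 1)) c₀ W) (x : TSite d (towerP L m (n + 1))),
      WL2.equiv ℂ (fun _ : TSite d (towerP L m (n + 1)) => c₀) W (PS y g) x =
        if blockCoord (L ^ (n + 1)) m (siteCast (towerP_eq_fineP_pow L m (n + 1)) x) = y then WL2.equiv ℂ (fun _ : TSite d (towerP L m (n + 1)) => c₀) W g x else 0)
    {p₂ CE κ κ' a : ℝ} (hp₂ : 0 ≤ p₂) (hCE : 0 ≤ CE) (ha : 0 ≤ a) (hlam : 0 < 1 - 2 * d * (η⁻¹) ^ 2 * (Real.cosh a - 1))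
    {k : ℕ} (hk : d ≤ k) (hη : 0 < η⁻¹) (hdiag : c₀ * (η⁻¹) ^ d = c₁) (hvol : ∀ ν, η⁻¹ ≤ (towerP L m (n + 1) ν : ℝ))
    (hκ' : 0 ≤ κ') (hκ : κ' ≤ κ) (hκ₁ : 2 * κ' < a * (L : ℝ) ^ (n + 1))
    (hP : ∀ (v : SiteL2K ℂ d (towerP L m (n + 1)) c₀ W) (x : TSite d (towerP L m (n + 1))),
      ‖WL2.equiv ℂ _ W (laplacePrimeAk L m n φ η U a' (c₁ := c₁) v -
        covLaplaceSiteK ((η : ℂ))⁻¹ (adTransportW φ U) (adTransportW φ fun b => (U b)⁻¹) v) x‖ ≤ p₂ * ‖PS (blockCoord (L ^ (n + 1)) m (siteCast (towerP_eq_fineP_pow L m (n + 1)) x)) v‖)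
    (hdec : ∀ v y : TSite d m, ‖PS y ∘L LinearMap.toContinuousLinearMap (GpOfUk L m n φ η U a' hpos') ∘L PS v‖ ≤
      CE * Real.exp (-(κ * tdist m v y))) :
    HasMaj
      (supSize (toB6 (torusGeom m η₀ L₀ M₀) R H)
        (fun y => Finset.univ.filter fun x : TSite d (towerP L m (n + 1)) => blockCoord (L ^ (n + 1)) m (siteCast (towerP_eq_fineP_pow L m (n + 1)) x) = UT.toSite m y)
        (fun x => UT.ofSite m (blockCoord (L ^ (n + 1)) m (siteCast (towerP_eq_fineP_pow L m (n + 1)) x))) : BlockNorm (toB6 (torusGeom m η₀ L₀ M₀) R H) (TSite d (towerP L m (n + 1)) → W))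
      (supSize (toB6 (torusGeom m η₀ L₀ M₀) R H)
        (fun y => Finset.univ.filter fun x : TSite d (towerP L m (n + 1)) => blockCoord (L ^ (n + 1)) m (siteCast (towerP_eq_fineP_pow L m (n + 1)) x) = UT.toSite m y)
        (fun x => UT.ofSite m (blockCoord (L ^ (n + 1)) m (siteCast (towerP_eq_fineP_pow L m (n + 1)) x))))
      (((WL2.linearEquiv ℂ ℂ (fun _ : TSite d (towerP L m (n + 1)) => c₀) :
            SiteL2K ℂ d (towerP L m (n + 1)) c₀ W ≃ₗ[ℂ] (TSite d (towerP L m (n + 1)) → W)).toLinearMap ∘ₗ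
          GpOfUk L m n φ η U a' (c₁ := c₁) hpos' ∘ₗ
          (WL2.linearEquiv ℂ ℂ (fun _ : TSite d (towerP L m (n + 1)) => c₀) :
            SiteL2K ℂ d (towerP L m (n + 1)) c₀ W ≃ₗ[ℂ] (TSite d (towerP L m (n + 1)) → W)).symm.toLinearMap).restrictScalars ℝ)
      (fun y v => ((1 + p₂ * CE * Real.sqrt (c₀ * (((L : ℝ) ^ (n + 1)) ^ d))) * (Real.exp (a * ((L : ℝ) ^ (n + 1) - 1)) * 2) *
            (∑ l ∈ Finset.range k, ((1 - 2 * d * (η⁻¹) ^ 2 * (Real.cosh a - 1)) ^ (l + 1))⁻¹) +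
          Real.sqrt (3 ^ d / c₁ * ((1 - 2 * d * (η⁻¹) ^ 2 * (Real.cosh a - 1)) ^ k)⁻¹) *
            Real.sqrt ((Real.exp (a * ((L : ℝ) ^ (n + 1) - 1)) * 2) * latticeConst d (a * (L : ℝ) ^ (n + 1) - 2 * κ')) * CE *
            Real.sqrt (c₀ * (((L : ℝ) ^ (n + 1)) ^ d))) *
        Real.exp (-(κ' * tdist m (UT.toSite m y) (UT.toSite m v)))) := by
  classical
  have hc₀ : 0 < c₀ := Fact.out
  have hB0 : 0 ≤ (1 + p₂ * CE * Real.sqrt (c₀ * (((L : ℝ) ^ (n + 1)) ^ d))) * (Real.exp (a * ((L : ℝ) ^ (n + 1) - 1)) * 2) *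
        (∑ l ∈ Finset.range k, ((1 - 2 * d * (η⁻¹) ^ 2 * (Real.cosh a - 1)) ^ (l + 1))⁻¹) +
      Real.sqrt (3 ^ d / c₁ * ((1 - 2 * d * (η⁻¹) ^ 2 * (Real.cosh a - 1)) ^ k)⁻¹) *
        Real.sqrt ((Real.exp (a * ((L : ℝ) ^ (n + 1) - 1)) * 2) * latticeConst d (a * (L : ℝ) ^ (n + 1) - 2 * κ')) * CE *
        Real.sqrt (c₀ * (((L : ℝ) ^ (n + 1)) ^ d)) :=
    add_nonneg (mul_nonneg (by positivity) (Finset.sum_nonneg fun l _ => inv_nonneg.2 (pow_nonneg hlam.le _))) (by positivity)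
  refine hasMaj_supSize_of_local (fun y x => mem_bigBox_iff y x) _ (fun y v => mul_nonneg hB0 (Real.exp_nonneg _)) ?_
  intro v f F hfv hfF x
  -- the carrier element `e⁻¹ f`, whose values are those of `f`
  set f' : SiteL2K ℂ d (towerP L m (n + 1)) c₀ W :=
    (WL2.linearEquiv ℂ ℂ (fun _ : TSite d (towerP L m (n + 1)) => c₀) :
      SiteL2K ℂ d (towerP L m (n + 1)) c₀ W ≃ₗ[ℂ] (TSite d (towerP L m (n + 1)) → W)).symm f with hf'
  have hfv' : ∀ y, blockCoord (L ^ (n + 1)) m (siteCast (towerP_eq_fineP_pow L m (n + 1)) y) ≠ UT.toSite m v →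
      WL2.equiv ℂ (fun _ : TSite d (towerP L m (n + 1)) => c₀) W f' y = 0 := by
    intro y hy
    have hne : UT.ofSite m (blockCoord (L ^ (n + 1)) m (siteCast (towerP_eq_fineP_pow L m (n + 1)) y)) ≠ v := fun h => hy ((ofSite_eq_iff _ _).1 h)
    exact hfv y hne
  have hfF' : ∀ y, ‖WL2.equiv ℂ (fun _ : TSite d (towerP L m (n + 1)) => c₀) W f' y‖ ≤ F := fun y => hfF y
  have hF0 : 0 ≤ F := (norm_nonneg _).trans (hfF x)
  -- the big-block mass, counted
  have hμsum : ∑ y : TSite d (towerP L m (n + 1)), (if blockCoord (L ^ (n + 1)) m (siteCast (towerP_eq_fineP_pow L m (n + 1)) y) = UT.toSite m v then c₀ else 0) ≤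
      c₀ * (((L : ℝ) ^ (n + 1)) ^ d) := by
    rw [← Finset.sum_filter, Finset.sum_const, nsmul_eq_mul, mul_comm]
    exact mul_le_mul_of_nonneg_left (by exact_mod_cast card_sites_bigBlock_le L m (n + 1) (UT.toSite m v)) hc₀.le
  have hμ : ‖f'‖ ≤ Real.sqrt (c₀ * (((L : ℝ) ^ (n + 1)) ^ d)) * F :=
    norm_le_sqrt_mass_mul (𝕜 := ℂ) (w := fun _ : TSite d (towerP L m (n + 1)) => c₀)
      (π := fun y => blockCoord (L ^ (n + 1)) m (siteCast (towerP_eq_fineP_pow L m (n + 1)) y)) (UT.toSite m v) hμsum f' hF0 hfv' hfF'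
  -- the road's letter at the output site `x`, (W)+(D-FS) inhabited by the `cosh` weight centred at `x` (NE9's T-B, BY NAME)
  have h := norm_GpOfUk_apply_le_decay_cosh L m n φ η U a' hpos' (c₁ := c₁) hR hS hPS hp₂ hCE ha hlam hk hη hdiag hvol hκ' hκ hκ₁ hP
    (hdec _) x f' hfv' hfF' hμ
  exact le_of_eq_of_le rfl (h.trans_eq (by simp only [UT.toSite_ofSite]))

/-- **THE SAME IN THE GEOMETRY's OWN DISTANCE, OPERATOR AS A CONTINUOUS LINEAR MAP**, at height `k = n+1` — the `hG` binder of
`Beta.RemainderChartOriginDerivative.ineq190_fderiv_chartH179_zero_of_letters` token for token (`𝒵 = 𝒴 = TSite d (towerP L m (n+1)) → W`, `b3 = bN = S_m`,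
`B_G = B_k`, `δ₀ = κ′∕d`), (W)+(D-FS) inhabited; letters (T), (D-P)_k, (D-E)_k.
[cite: Balaban1985BackgroundPropagators, Thm 3.1 (3.42) p.397] [cite: Balaban1985Variational, (180) p.306, (182) p.307, (190) p.308] [cite: Balaban1984PropagatorsII, (2.51)–(2.52) p.232, (2.54) p.233] -/
theorem hasMaj_GpOfUk_of_cosh_letters
    (hR : ∀ b w, ‖adTransportW φ U b w‖ ≤ ‖w‖) (hS : ∀ b w, ‖adTransportW φ (fun b => (U b)⁻¹) b w‖ ≤ ‖w‖)
    {PS : TSite d m → SiteL2K ℂ d (towerP L m (n + 1)) c₀ W →L[ℂ] SiteL2K ℂ d (towerP L m (n + 1)) c₀ W}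
    (hPS : ∀ (y : TSite d m) (g : SiteL2K ℂ d (towerP L m (n + 1)) c₀ W) (x : TSite d (towerP L m (n + 1))),
      WL2.equiv ℂ (fun _ : TSite d (towerP L m (n + 1)) => c₀) W (PS y g) x =
        if blockCoord (L ^ (n + 1)) m (siteCast (towerP_eq_fineP_pow L m (n + 1)) x) = y then WL2.equiv ℂ (fun _ : TSite d (towerP L m (n + 1)) => c₀) W g x else 0)
    {p₂ CE κ κ' a : ℝ} (hp₂ : 0 ≤ p₂) (hCE : 0 ≤ CE) (ha : 0 ≤ a) (hlam : 0 < 1 - 2 * d * (η⁻¹) ^ 2 * (Real.cosh a - 1))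
    {k : ℕ} (hk : d ≤ k) (hη : 0 < η⁻¹) (hdiag : c₀ * (η⁻¹) ^ d = c₁) (hvol : ∀ ν, η⁻¹ ≤ (towerP L m (n + 1) ν : ℝ))
    (hκ' : 0 ≤ κ') (hκ : κ' ≤ κ) (hκ₁ : 2 * κ' < a * (L : ℝ) ^ (n + 1))
    (hP : ∀ (v : SiteL2K ℂ d (towerP L m (n + 1)) c₀ W) (x : TSite d (towerP L m (n + 1))),
      ‖WL2.equiv ℂ _ W (laplacePrimeAk L m n φ η U a' (c₁ := c₁) v -
        covLaplaceSiteK ((η : ℂ))⁻¹ (adTransportW φ U) (adTransportW φ fun b => (U b)⁻¹) v) x‖ ≤ p₂ * ‖PS (blockCoord (L ^ (n + 1)) m (siteCast (towerP_eq_fineP_pow L m (n + 1)) x)) v‖)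
    (hdec : ∀ v y : TSite d m, ‖PS y ∘L LinearMap.toContinuousLinearMap (GpOfUk L m n φ η U a' hpos') ∘L PS v‖ ≤
      CE * Real.exp (-(κ * tdist m v y))) :
    HasMaj
      (supSize (toB6 (torusGeom m η₀ L₀ M₀) R H)
        (fun y => Finset.univ.filter fun x : TSite d (towerP L m (n + 1)) => blockCoord (L ^ (n + 1)) m (siteCast (towerP_eq_fineP_pow L m (n + 1)) x) = UT.toSite m y)
        (fun x => UT.ofSite m (blockCoord (L ^ (n + 1)) m (siteCast (towerP_eq_fineP_pow L m (n + 1)) x))) : BlockNorm (toB6 (torusGeom m η₀ L₀ M₀) R H) (TSite d (towerP L m (n + 1)) → W))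
      (supSize (toB6 (torusGeom m η₀ L₀ M₀) R H)
        (fun y => Finset.univ.filter fun x : TSite d (towerP L m (n + 1)) => blockCoord (L ^ (n + 1)) m (siteCast (towerP_eq_fineP_pow L m (n + 1)) x) = UT.toSite m y)
        (fun x => UT.ofSite m (blockCoord (L ^ (n + 1)) m (siteCast (towerP_eq_fineP_pow L m (n + 1)) x))))
      (((LinearMap.toContinuousLinearMap
          ((WL2.linearEquiv ℂ ℂ (fun _ : TSite d (towerP L m (n + 1)) => c₀) :
              SiteL2K ℂ d (towerP L m (n + 1)) c₀ W ≃ₗ[ℂ] (TSite d (towerP L m (n + 1)) → W)).toLinearMap ∘ₗ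
            GpOfUk L m n φ η U a' (c₁ := c₁) hpos' ∘ₗ
            (WL2.linearEquiv ℂ ℂ (fun _ : TSite d (towerP L m (n + 1)) => c₀) :
              SiteL2K ℂ d (towerP L m (n + 1)) c₀ W ≃ₗ[ℂ] (TSite d (towerP L m (n + 1)) → W)).symm.toLinearMap)).restrictScalars ℝ :
          (TSite d (towerP L m (n + 1)) → W) →ₗ[ℝ] (TSite d (towerP L m (n + 1)) → W)))
      (fun y v => ((1 + p₂ * CE * Real.sqrt (c₀ * (((L : ℝ) ^ (n + 1)) ^ d))) * (Real.exp (a * ((L : ℝ) ^ (n + 1) - 1)) * 2) *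
            (∑ l ∈ Finset.range k, ((1 - 2 * d * (η⁻¹) ^ 2 * (Real.cosh a - 1)) ^ (l + 1))⁻¹) +
          Real.sqrt (3 ^ d / c₁ * ((1 - 2 * d * (η⁻¹) ^ 2 * (Real.cosh a - 1)) ^ k)⁻¹) *
            Real.sqrt ((Real.exp (a * ((L : ℝ) ^ (n + 1) - 1)) * 2) * latticeConst d (a * (L : ℝ) ^ (n + 1) - 2 * κ')) * CE *
            Real.sqrt (c₀ * (((L : ℝ) ^ (n + 1)) ^ d))) *
        Real.exp (-(κ' / d * (toB6 (torusGeom m η₀ L₀ M₀) R H).dist y v))) := by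
  have hB0 : 0 ≤ (1 + p₂ * CE * Real.sqrt (c₀ * (((L : ℝ) ^ (n + 1)) ^ d))) * (Real.exp (a * ((L : ℝ) ^ (n + 1) - 1)) * 2) *
        (∑ l ∈ Finset.range k, ((1 - 2 * d * (η⁻¹) ^ 2 * (Real.cosh a - 1)) ^ (l + 1))⁻¹) +
      Real.sqrt (3 ^ d / c₁ * ((1 - 2 * d * (η⁻¹) ^ 2 * (Real.cosh a - 1)) ^ k)⁻¹) *
        Real.sqrt ((Real.exp (a * ((L : ℝ) ^ (n + 1) - 1)) * 2) * latticeConst d (a * (L : ℝ) ^ (n + 1) - 2 * κ')) * CE *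
        Real.sqrt (c₀ * (((L : ℝ) ^ (n + 1)) ^ d)) :=
    add_nonneg (mul_nonneg (by positivity) (Finset.sum_nonneg fun l _ => inv_nonneg.2 (pow_nonneg hlam.le _))) (by positivity)
  have h := hasMaj_GpOfUk_of_cosh_letters_sup L m n φ η U a' hpos' η₀ L₀ M₀ R H (c₁ := c₁) hR hS hPS hp₂ hCE ha hlam hk hη hdiag hvol hκ'
    hκ hκ₁ hP hdec
  exact (h.mono fun y v => mul_le_mul_of_nonneg_left (exp_tdist_le_exp_tdist1 hκ' y v) hB0).congr fun μ => rfl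

end Road

/-! ## (T) inhabited on the chain's class: unitary `U`, `*`-trace, compatible fibre norm -/

section Unitary

variable {d : ℕ} (L : ℕ) [NeZero L] (m : Fin d → ℕ) [∀ i, NeZero (m i)] (n : ℕ)
  {𝔸 : Type*} [NormedRing 𝔸] [StarRing 𝔸] [NormedAlgebra ℂ 𝔸] [CompleteSpace 𝔸]
  {W : Type} [NormedAddCommGroup W] [InnerProductSpace ℂ W] [FiniteDimensional ℂ W] (φ : W ≃ₗ[ℂ] 𝔸) {c₀ : ℝ} [Fact (0 < c₀)]
  (η : ℝ) (U : Bond d (towerP L m (n + 1)) → 𝔸ˣ) {c₁ : ℝ} [Fact (0 < c₁)] (a' : ℝ)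
  (hpos' : ∀ x : SiteL2K ℂ d (towerP L m (n + 1)) c₀ W, x ≠ 0 → 0 < RCLike.re ⟪x, laplacePrimeAk L m n φ η U a' (c₁ := c₁) x⟫_ℂ)
  (η₀ L₀ M₀ R : ℝ) (H : Prop)

/-- **ON THE CHAIN's CLASS ONLY (D-P)_k AND (D-E)_k REMAIN**: for unitary `U` (`U_b* = U_b⁻¹`), a `*`-trace `τ` and the compatible fibre norm
`⟪φ⁻¹X, φ⁻¹Y⟫ = τ(X*Y)` the contraction letters (T) hold with equality (`B9Eq342GreenPrimeSupBound.norm_adTransportW_eq` ∕ `…_inv_eq`, as in the road's own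
`norm_GpOfUk_apply_le_rowSum_cosh_unitary`), so `hasMaj_GpOfUk_of_cosh_letters` holds modulo (D-P)_k `hP` and (D-E)_k `hdec` alone.
[cite: Balaban1985BackgroundPropagators, Thm 3.1 (3.42) p.397, (3.39) p.397, (3.8) p.392] [cite: Balaban1985Variational, (180) p.306, (190) p.308] -/
theorem hasMaj_GpOfUk_of_cosh_letters_unitary (τ : 𝔸 →ₗ[ℂ] ℂ) (hτ₂ : ∀ X Y : 𝔸, τ (X * Y) = τ (Y * X))
    (hU : ∀ b, star (U b : 𝔸) = ((U b)⁻¹ : 𝔸ˣ)) (hφ : ∀ X Y : 𝔸, ⟪φ.symm X, φ.symm Y⟫_ℂ = τ (star X * Y))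
    {PS : TSite d m → SiteL2K ℂ d (towerP L m (n + 1)) c₀ W →L[ℂ] SiteL2K ℂ d (towerP L m (n + 1)) c₀ W}
    (hPS : ∀ (y : TSite d m) (g : SiteL2K ℂ d (towerP L m (n + 1)) c₀ W) (x : TSite d (towerP L m (n + 1))),
      WL2.equiv ℂ (fun _ : TSite d (towerP L m (n + 1)) => c₀) W (PS y g) x =
        if blockCoord (L ^ (n + 1)) m (siteCast (towerP_eq_fineP_pow L m (n + 1)) x) = y then WL2.equiv ℂ (fun _ : TSite d (towerP L m (n + 1)) => c₀) W g x else 0)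
    {p₂ CE κ κ' a : ℝ} (hp₂ : 0 ≤ p₂) (hCE : 0 ≤ CE) (ha : 0 ≤ a) (hlam : 0 < 1 - 2 * d * (η⁻¹) ^ 2 * (Real.cosh a - 1))
    {k : ℕ} (hk : d ≤ k) (hη : 0 < η⁻¹) (hdiag : c₀ * (η⁻¹) ^ d = c₁) (hvol : ∀ ν, η⁻¹ ≤ (towerP L m (n + 1) ν : ℝ))
    (hκ' : 0 ≤ κ') (hκ : κ' ≤ κ) (hκ₁ : 2 * κ' < a * (L : ℝ) ^ (n + 1))
    (hP : ∀ (v : SiteL2K ℂ d (towerP L m (n + 1)) c₀ W) (x : TSite d (towerP L m (n + 1))),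
      ‖WL2.equiv ℂ _ W (laplacePrimeAk L m n φ η U a' (c₁ := c₁) v -
        covLaplaceSiteK ((η : ℂ))⁻¹ (adTransportW φ U) (adTransportW φ fun b => (U b)⁻¹) v) x‖ ≤ p₂ * ‖PS (blockCoord (L ^ (n + 1)) m (siteCast (towerP_eq_fineP_pow L m (n + 1)) x)) v‖)
    (hdec : ∀ v y : TSite d m, ‖PS y ∘L LinearMap.toContinuousLinearMap (GpOfUk L m n φ η U a' hpos') ∘L PS v‖ ≤
      CE * Real.exp (-(κ * tdist m v y))) :
    HasMaj
      (supSize (toB6 (torusGeom m η₀ L₀ M₀) R H)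
        (fun y => Finset.univ.filter fun x : TSite d (towerP L m (n + 1)) => blockCoord (L ^ (n + 1)) m (siteCast (towerP_eq_fineP_pow L m (n + 1)) x) = UT.toSite m y)
        (fun x => UT.ofSite m (blockCoord (L ^ (n + 1)) m (siteCast (towerP_eq_fineP_pow L m (n + 1)) x))) : BlockNorm (toB6 (torusGeom m η₀ L₀ M₀) R H) (TSite d (towerP L m (n + 1)) → W))
      (supSize (toB6 (torusGeom m η₀ L₀ M₀) R H)
        (fun y => Finset.univ.filter fun x : TSite d (towerP L m (n + 1)) => blockCoord (L ^ (n + 1)) m (siteCast (towerP_eq_fineP_pow L m (n + 1)) x) = UT.toSite m y)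
        (fun x => UT.ofSite m (blockCoord (L ^ (n + 1)) m (siteCast (towerP_eq_fineP_pow L m (n + 1)) x))))
      (((LinearMap.toContinuousLinearMap
          ((WL2.linearEquiv ℂ ℂ (fun _ : TSite d (towerP L m (n + 1)) => c₀) :
              SiteL2K ℂ d (towerP L m (n + 1)) c₀ W ≃ₗ[ℂ] (TSite d (towerP L m (n + 1)) → W)).toLinearMap ∘ₗ
            GpOfUk L m n φ η U a' (c₁ := c₁) hpos' ∘ₗ
            (WL2.linearEquiv ℂ ℂ (fun _ : TSite d (towerP L m (n + 1)) => c₀) :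
              SiteL2K ℂ d (towerP L m (n + 1)) c₀ W ≃ₗ[ℂ] (TSite d (towerP L m (n + 1)) → W)).symm.toLinearMap)).restrictScalars ℝ :
          (TSite d (towerP L m (n + 1)) → W) →ₗ[ℝ] (TSite d (towerP L m (n + 1)) → W)))
      (fun y v => ((1 + p₂ * CE * Real.sqrt (c₀ * (((L : ℝ) ^ (n + 1)) ^ d))) * (Real.exp (a * ((L : ℝ) ^ (n + 1) - 1)) * 2) *
            (∑ l ∈ Finset.range k, ((1 - 2 * d * (η⁻¹) ^ 2 * (Real.cosh a - 1)) ^ (l + 1))⁻¹) +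
          Real.sqrt (3 ^ d / c₁ * ((1 - 2 * d * (η⁻¹) ^ 2 * (Real.cosh a - 1)) ^ k)⁻¹) *
            Real.sqrt ((Real.exp (a * ((L : ℝ) ^ (n + 1) - 1)) * 2) * latticeConst d (a * (L : ℝ) ^ (n + 1) - 2 * κ')) * CE *
            Real.sqrt (c₀ * (((L : ℝ) ^ (n + 1)) ^ d))) *
        Real.exp (-(κ' / d * (toB6 (torusGeom m η₀ L₀ M₀) R H).dist y v))) :=
  hasMaj_GpOfUk_of_cosh_letters L m n φ η U a' hpos' η₀ L₀ M₀ R H (c₁ := c₁)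
    (fun b w => (norm_adTransportW_eq φ U τ hτ₂ hU hφ b w).le) (fun b w => (norm_adTransportW_inv_eq φ U τ hτ₂ hU hφ b w).le)
    hPS hp₂ hCE ha hlam hk hη hdiag hvol hκ' hκ hκ₁ hP hdec

end Unitary

end Literature.MathematicalPhysics.QuantumFieldTheory.Balaban1983to89.Beta.RemainderHasMajGreenPrimeTowerDecayCosh

end
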